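import Literature.NumberTheory.DiophantineGeometry.TateAlgorithmIstarSuccNormalFormProofs
import Literature.NumberTheory.DiophantineGeometry.ConductorExponentLeEightProofs
import Literature.NumberTheory.DiophantineGeometry.TateAlgorithmProofs
import Literature.NumberTheory.DiophantineGeometry.ConductorAdditiveProofs
import Literature.NumberTheory.DiophantineGeometry.MinimalDiscriminantNormProofs
import Literature.NumberTheory.EllipticCurves.MultiplicativeReductionJValuationProofs
import HarnessLib

/-!
# Crux `SingleTowerSzpiro` (stmt-ABC-22410), line `birth` — stub `stub_potentiallyGoodOrdTwo`

The `2`-adic remainder of the POTENTIALLY-GOOD part of the single-tower bound (registered stub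
`stub_potentiallyGoodOrdTwo` of `Cruxes/SingleTowerSzpiro/Lines/birth.lean`, rev 2): there is an absolute
constant `B` (`= 18`) such that for every elliptic curve `E/ℚ` and the finite place `v` of `ℤ` over `2`,
if `j_E` is `v`-integral (`v.valuation ℚ E.j ≤ 1`, potentially good reduction) then

  `ord_2(Δ_min(E)) ≤ B`.

Proof (Tate's algorithm over `O_v ≃ ℤ₂`, where `2` is a uniformiser; every input is PROVED in the tree).
Let `M` be the integral local minimal model at `v` and `T` the Kodaira symbol Tate's algorithm
(`WeierstrassCurve.kodairaSymbolOfMinimal`, Silverman ATAEC IV.9.4) returns on it.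
* `T = Iₙ`, `n ≥ 1` is multiplicative reduction (`WeierstrassCurve.kodairaSymbolAt_eq_I_iff_holds`), where
  `|j|_v = exp(ord_v Δ_min) > 1`
  (`WeierstrassCurve.valuation_j_eq_exp_ordMinimalDiscriminant_of_hasMultiplicativeReductionAt`) — excluded.
* `T = Iₙ*`, `n ≥ 1` (at `2` these DO occur with `v(j) ≥ 0`): by the tree's normal form
  `TateAlgorithm.exists_smul_of_kodairaSymbolOfMinimal_eq_Istar_succ` some `O_v`-isomorphic integral model
  has `2 ∣ a₁`, `2 ∥ a₂`, `4 ∣ a₃`, `8 ∣ a₄` (IV.9.4 Step 7: "translate `x` so that the double root of `P(T)`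
  is `T = 0`; then `π² ∤ a₂`, `π³ ∣ a₄`"); writing `a₁ = 2α`, `a₂ = 2p` (`p` a unit), `a₃ = 4γ`, `a₄ = 8q`
  gives `c₄ = b₂² − 24 b₄ = 16·(α⁴ + 2(2α²p + 2p² − 12q − 6αγ))`, so `ord₂ c₄ = 4` if `α` is a unit and
  `c₄ = 64·(p² + 2(2β⁴ + 2β²p − 3q − 3βγ))`, `ord₂ c₄ = 6`, if `α = 2β`
  (`addVal_c₄_toNat_of_istarNormalForm_two`; these are the values `v(c₄) ∈ {4, 6}` of the `Iₙ*` rows of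
  Papadopoulos 1993, Table IV). Since `c₄` changes by a unit under `O_v`-isomorphisms and `j·Δ(M) = c₄(M)³`,
  `ord_2(Δ_min) = 3·ord₂ c₄(M) − ord₂(j) ≤ 18`.
* every other `T` has `m(T) ≤ 9` components, and Ogg's formula — the tree's DEFINITION
  `f_v = ord_v(Δ_min) + 1 − m_v`, with `m_v ≤ ord_v(Δ_min) + 1` (`WeierstrassCurve.numComponentsAt_le_holds`) —
  together with `f_2 ≤ 8` (`WeierstrassCurve.conductorExponent_le_eight_holds`, ATAEC IV.10.4) gives
  `ord_2(Δ_min) = f + m − 1 ≤ 16`.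
(The sharp value over `ℚ₂` is smaller; any absolute `B` serves the composition `SingleTowerSzpiro_of`, where
the place `2` contributes the constant `B·log 2`.)

HONESTY: a classical bookkeeping piece of the line, NOT progress on the crux `SingleTowerSzpiro`
(all difficulty sits in `stub_multiplicativeTower`); abc is not proved by any of this; A-PS / A1′ are NOT
abc; typed ≠ proved. No `sorry`, no new axiom, no `def`.

References: J. H. Silverman, *Advanced Topics in the Arithmetic of Elliptic Curves*, GTM 151 (1994),
IV.9.4 (Step 7), Table 4.1, Thm IV.10.4; I. Papadopoulos, *Sur la classification de Néron des courbes
elliptiques en caractéristique résiduelle 2 et 3*, J. Number Theory 44 (1993), 119–152, Table IV.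
-/

noncomputable section

-- `Summit.<Summit>.<Problem>` is the mandated summit-side namespace (CONVENTIONS §2); for the
-- single-conjunct summit `ABC` the two coincide, so the duplicate `ABC.ABC` is deliberate.
set_option linter.dupNamespace false

namespace Summit.ABC.ABC.Theorems.SingleTowerSzpiroLine

open IsDedekindDomain IsLocalRing Literature.NumberTheory.DiophantineGeometry
open Literature.NumberTheory.DiophantineGeometry.TateAlgorithm
open IsDiscreteValuationRing hiding maximalIdeal

section DVR

variable {R : Type*} [CommRing R] [IsDomain R] [IsDiscreteValuationRing R]

/-- **`ord c₄ ∈ {4, 6}` on the `Iₙ*` normal form when `2` is a uniformiser.** On an integral model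
over a DVR in which `2` is a uniformiser with `2 ∣ a₁`, `a₂ = 2p` (`p` a unit), `4 ∣ a₃`, `8 ∣ a₄` (the
initial model of Step 7 of Tate's algorithm, Silverman ATAEC IV.9.4), `c₄ = 16(α⁴ + 2·J)` with `a₁ = 2α`,
so `ord c₄ = 4` if `α` is a unit and `ord c₄ = 6` otherwise (`c₄ = 64(p² + 2·J')`).
Papadopoulos 1993, Table IV (rows `Iₙ*`, `v(c₄) = 4, 6`). [folklore] -/
theorem addVal_c₄_toNat_of_istarNormalForm_two (h2 : Irreducible (2 : R)) (V : WeierstrassCurve R)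
    (ha₁ : 2 ∣ V.a₁) {p : R} (ha₂ : V.a₂ = 2 * p) (hp : IsUnit p) (ha₃ : 2 ^ 2 ∣ V.a₃)
    (ha₄ : 2 ^ 3 ∣ V.a₄) :
    (addVal R V.c₄).toNat = 4 ∨ (addVal R V.c₄).toNat = 6 := by
  obtain ⟨α, hα⟩ := ha₁
  obtain ⟨γ, hγ⟩ := ha₃
  obtain ⟨q, hq⟩ := ha₄
  by_cases hαu : IsUnit α
  · left
    have e : (1 : R) * V.c₄ =
        2 ^ 4 * (α ^ 4 + 2 * (2 * α ^ 2 * p + 2 * p ^ 2 - 12 * q - 6 * α * γ)) := by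
      simp only [WeierstrassCurve.c₄, WeierstrassCurve.b₂, WeierstrassCurve.b₄, hα, ha₂, hγ, hq]
      ring
    exact addVal_toNat_eq_of_eq_add h2 isUnit_one (hαu.pow 4) e
  · right
    obtain ⟨β, hβ⟩ := (not_isUnit_iff_dvd h2 _).mp hαu
    have e : (1 : R) * V.c₄ =
        2 ^ 6 * (p ^ 2 + 2 * (2 * β ^ 4 + 2 * β ^ 2 * p - 3 * q - 3 * β * γ)) := by
      simp only [WeierstrassCurve.c₄, WeierstrassCurve.b₂, WeierstrassCurve.b₄, hα, ha₂, hγ, hq, hβ]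
      ring
    exact addVal_toNat_eq_of_eq_add h2 isUnit_one (hp.pow 2) e

/-- **Type `Iₙ*`, `n ≥ 1`, has `ord c₄ ∈ {4, 6}` when `2` is a uniformiser** (perfect residue field).
If Tate's algorithm (`WeierstrassCurve.kodairaSymbolOfMinimal`) returns `Istar (n + 1)` on `V`, then an
`R`-isomorphic model `D • V` is in the Step-7 normal form `2 ∣ a₁`, `2 ∥ a₂`, `4 ∣ a₃`, `8 ∣ a₄`
(`TateAlgorithm.exists_smul_of_kodairaSymbolOfMinimal_eq_Istar_succ`, Silverman ATAEC IV.9.4 Step 7), and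
`c₄(D • V) = u⁻⁴ c₄(V)` for the unit `u = D.u`; conclude by `addVal_c₄_toNat_of_istarNormalForm_two`.
In particular `c₄(V) ≠ 0` and `ord c₄(V) ≤ 6`. [folklore] -/
theorem addVal_c₄_toNat_of_kodairaSymbolOfMinimal_eq_Istar_succ_two [PerfectField (ResidueField R)]
    (h2 : Irreducible (2 : R)) (V : WeierstrassCurve R) {n : ℕ}
    (hV : V.kodairaSymbolOfMinimal = .Istar (n + 1)) :
    (addVal R V.c₄).toNat = 4 ∨ (addVal R V.c₄).toNat = 6 := by
  obtain ⟨D, h₁, h₂, h₂', h₃, h₄, -⟩ := exists_smul_of_kodairaSymbolOfMinimal_eq_Istar_succ V hV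
  have h2m : ∀ {x : R} {k : ℕ}, x ∈ maximalIdeal R ^ k ↔ (2 : R) ^ k ∣ x := fun {x k} =>
    mem_maximalIdeal_pow_iff_dvd_of_irreducible h2 x k
  have h2m₁ : ∀ {x : R}, x ∈ maximalIdeal R ↔ (2 : R) ∣ x := fun {x} =>
    mem_maximalIdeal_iff_dvd_of_irreducible h2 x
  obtain ⟨p, hp⟩ := h2m₁.mp h₂
  have hpu : IsUnit p := by
    rw [isUnit_iff_not_dvd h2]
    rintro ⟨p', rfl⟩
    exact h₂' (h2m.mpr ⟨p', by rw [hp]; ring⟩)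
  have hDV := addVal_c₄_toNat_of_istarNormalForm_two h2 (D • V) (h2m₁.mp h₁) hp hpu (h2m.mp h₃)
    (h2m.mp h₄)
  have hc : addVal R (D • V).c₄ = addVal R V.c₄ := by
    rw [WeierstrassCurve.variableChange_c₄, addVal_mul, addVal_eq_zero_iff.mpr (D.u⁻¹.isUnit.pow 4),
      zero_add]
  rwa [hc] at hDV

end DVR

/-! ## Over `ℚ` at the place above `2` -/

/-- At any place, a Kodaira type with at most `9` components forces `ord_v(Δ_min) ≤ 16` over `ℚ`:
Ogg's formula `f_v = ord_v(Δ_min) + 1 − m_v` is the tree's definition of `f_v`, `m_v ≤ ord_v(Δ_min) + 1`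
(`WeierstrassCurve.numComponentsAt_le_holds`) and `f_v ≤ 8` (`WeierstrassCurve.conductorExponent_le_eight_holds`,
Silverman ATAEC IV.10.4). [folklore] -/
theorem ordMinimalDiscriminant_le_sixteen_of_numComponentsAt_le_nine (W : WeierstrassCurve ℚ)
    [W.IsElliptic] (v : HeightOneSpectrum ℤ) (hm : W.numComponentsAt v ≤ 9) :
    W.ordMinimalDiscriminant v ≤ 16 := by
  have hf8 : W.conductorExponent v ≤ 8 := WeierstrassCurve.conductorExponent_le_eight_holds W v
  have hmle : W.numComponentsAt v ≤ W.ordMinimalDiscriminant v + 1 :=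
    WeierstrassCurve.numComponentsAt_le_holds v W
  have hfdef : W.conductorExponent v = W.ordMinimalDiscriminant v + 1 - W.numComponentsAt v := rfl
  omega

/-- **Type `Iₙ*`, `n ≥ 1`, at the place over `2` with `v(j) ≥ 0` forces `ord_2(Δ_min) ≤ 18`.** On the
integral local minimal model `M` over `O_v ≃ ℤ₂` (`2` a uniformiser,
`Literature.NumberTheory.DiophantineGeometry.Rat.irreducible_natCast_natGenerator`), `ord c₄(M) ≤ 6`
(`addVal_c₄_toNat_of_kodairaSymbolOfMinimal_eq_Istar_succ_two`) and `j · Δ(M) = c₄(M)³` with `j = j(E)`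
a `K_v`-isomorphism invariant, so `ord_2(Δ_min) = 3 ord c₄(M) − ord(j) ≤ 18` when `ord(j) ≥ 0`.
Silverman ATAEC IV.9.4 Step 7; Papadopoulos 1993, Table IV. [folklore] -/
theorem ordMinimalDiscriminant_le_eighteen_of_kodairaSymbolAt_eq_Istar_succ (W : WeierstrassCurve ℚ)
    [W.IsElliptic] (v : HeightOneSpectrum ℤ) (hv : Rat.HeightOneSpectrum.natGenerator v = 2)
    (hj : v.valuation ℚ W.j ≤ 1) {n : ℕ} (hT : W.kodairaSymbolAt v = .Istar (n + 1)) :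
    W.ordMinimalDiscriminant v ≤ 18 := by
  rw [WeierstrassCurve.kodairaSymbolAt_def] at hT
  set M := W.localMinimalIntegralModel v with hM
  have hΔ0 : M.Δ ≠ 0 := WeierstrassCurve.localMinimalIntegralModel_Δ_ne_zero v W
  have h2 : Irreducible (2 : v.adicCompletionIntegers ℚ) := by
    have h := Literature.NumberTheory.DiophantineGeometry.Rat.irreducible_natCast_natGenerator v
    rw [hv] at h
    simpa using h
  have hc₄ := addVal_c₄_toNat_of_kodairaSymbolOfMinimal_eq_Istar_succ_two h2 M hT
  have hc₄le : (addVal (v.adicCompletionIntegers ℚ) M.c₄).toNat ≤ 6 := by omega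
  have hc₄0 : M.c₄ ≠ 0 := by
    intro h0
    rw [h0, addVal_zero] at hc₄
    simp at hc₄
  -- valuations on `K_v`
  obtain ⟨N, hN, hvΔ⟩ := HeightOneSpectrum.exists_addVal_adicCompletionIntegers_eq ℚ v M.Δ hΔ0
  obtain ⟨N₄, hN₄, hvc₄⟩ := HeightOneSpectrum.exists_addVal_adicCompletionIntegers_eq ℚ v M.c₄ hc₄0
  have hord : W.ordMinimalDiscriminant v = N := by
    show (addVal (v.adicCompletionIntegers ℚ) M.Δ).toNat = N
    rw [hN]; rfl
  have hN₄le : N₄ ≤ 6 := by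
    have : (addVal (v.adicCompletionIntegers ℚ) M.c₄).toNat = N₄ := by rw [hN₄]; rfl
    omega
  -- `j · Δ(M) = c₄(M)³` in `K_v`
  have hjΔ : ∀ (E : WeierstrassCurve (v.adicCompletion ℚ)) [E.IsElliptic],
      E.j * E.Δ = E.c₄ ^ 3 := fun E _ ↦ by
    rw [WeierstrassCurve.j, ← WeierstrassCurve.coe_Δ', mul_comm, ← mul_assoc, Units.mul_inv, one_mul]
  haveI hXell : (W.baseChange (v.adicCompletion ℚ)).IsElliptic := by
    unfold WeierstrassCurve.baseChange; infer_instance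
  obtain ⟨C, hC⟩ : ∃ C : WeierstrassCurve.VariableChange (v.adicCompletion ℚ),
      C • W.baseChange (v.adicCompletion ℚ) = W.localMinimalModel v := ⟨_, rfl⟩
  have key : algebraMap ℚ (v.adicCompletion ℚ) W.j * (M.Δ : v.adicCompletion ℚ) =
      (M.c₄ : v.adicCompletion ℚ) ^ 3 := by
    have hj' : (C • W.baseChange (v.adicCompletion ℚ)).j = algebraMap ℚ (v.adicCompletion ℚ) W.j := by
      rw [WeierstrassCurve.variableChange_j]; exact W.map_j _
    have hΔ' : (M.Δ : v.adicCompletion ℚ) = (C • W.baseChange (v.adicCompletion ℚ)).Δ := by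
      rw [hC, hM, WeierstrassCurve.localMinimalIntegralModel]
      exact WeierstrassCurve.integralModel_Δ_eq (v.adicCompletionIntegers ℚ) (W.localMinimalModel v)
    have hc₄' : (M.c₄ : v.adicCompletion ℚ) =
        (C • W.baseChange (v.adicCompletion ℚ)).c₄ := by
      rw [hC, hM, WeierstrassCurve.localMinimalIntegralModel]
      exact WeierstrassCurve.integralModel_c₄_eq (v.adicCompletionIntegers ℚ) (W.localMinimalModel v)
    rw [hΔ', hc₄', ← hj']
    exact hjΔ _
  -- read off `exp(-N) ≥ exp(-3 N₄)` from `|j|_v ≤ 1`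
  have hvj : Valued.v (algebraMap ℚ (v.adicCompletion ℚ) W.j) ≤ 1 := by
    rw [WeierstrassCurve.valued_algebraMap_adicCompletion]; exact hj
  have h := congrArg Valued.v key
  rw [map_mul, map_pow, hvΔ, hvc₄, ← WithZero.exp_nsmul] at h
  have hle : WithZero.exp (3 • (-(N₄ : ℤ))) ≤ WithZero.exp (-(N : ℤ)) := by
    rw [← h]
    calc Valued.v (algebraMap ℚ (v.adicCompletion ℚ) W.j) * WithZero.exp (-(N : ℤ))
        ≤ 1 * WithZero.exp (-(N : ℤ)) := mul_le_mul' hvj le_rfl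
      _ = WithZero.exp (-(N : ℤ)) := one_mul _
  rw [WithZero.exp_le_exp, smul_neg, neg_le_neg_iff, nsmul_eq_mul] at hle
  push_cast at hle
  omega

/-- **Stub `stub_potentiallyGoodOrdTwo` of line `birth` (crux stmt-ABC-22410), with `B = 18`.** For every
elliptic curve `E/ℚ`: if `j_E` is integral at `2` then `ord_2(Δ_min(E)) ≤ 18`. Case split on the Kodaira
symbol at `2`: `Iₙ` (`n ≥ 1`) is multiplicative and contradicts `|j|₂ ≤ 1`; `Iₙ*` (`n ≥ 1`) gives `≤ 18`
(`ordMinimalDiscriminant_le_eighteen_of_kodairaSymbolAt_eq_Istar_succ`); all other types have `m ≤ 9`, so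
`≤ 16` (`ordMinimalDiscriminant_le_sixteen_of_numComponentsAt_le_nine`). Silverman ATAEC IV.9.4, Table 4.1,
IV.10.4; Papadopoulos 1993, Table IV. [folklore] -/
theorem stub_potentiallyGoodOrdTwo : ∃ B : ℕ, ∀ (W : WeierstrassCurve ℚ) [W.IsElliptic] (v : HeightOneSpectrum ℤ), Rat.HeightOneSpectrum.natGenerator v = 2 → v.valuation ℚ W.j ≤ 1 → W.ordMinimalDiscriminant v ≤ B := by
  refine ⟨18, fun W _ v hv hj => ?_⟩
  have h16 : W.numComponentsAt v ≤ 9 → W.ordMinimalDiscriminant v ≤ 18 := fun hm =>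
    (ordMinimalDiscriminant_le_sixteen_of_numComponentsAt_le_nine W v hm).trans (by norm_num)
  rcases hk : W.kodairaSymbolAt v with n | _ | _ | _ | n | _ | _ | _
  · rcases n with _ | n
    · exact h16 (by unfold WeierstrassCurve.numComponentsAt; rw [hk]; simp [KodairaSymbol.numComponents])
    · -- `Iₙ`, `n ≥ 1`: multiplicative reduction, `|j|_v = exp(ord_v Δ_min) > 1`
      obtain ⟨hm, hord⟩ :=
        (WeierstrassCurve.kodairaSymbolAt_eq_I_iff_holds v W (Nat.succ_ne_zero n)).mp hk
      have h :=
        WeierstrassCurve.valuation_j_eq_exp_ordMinimalDiscriminant_of_hasMultiplicativeReductionAt v W hm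
      rw [h, ← WithZero.exp_zero, WithZero.exp_le_exp] at hj
      omega
  · exact h16 (by unfold WeierstrassCurve.numComponentsAt; rw [hk]; simp [KodairaSymbol.numComponents])
  · exact h16 (by unfold WeierstrassCurve.numComponentsAt; rw [hk]; simp [KodairaSymbol.numComponents])
  · exact h16 (by unfold WeierstrassCurve.numComponentsAt; rw [hk]; simp [KodairaSymbol.numComponents])
  · rcases n with _ | n
    · exact h16 (by unfold WeierstrassCurve.numComponentsAt; rw [hk]; simp [KodairaSymbol.numComponents])
    · exact ordMinimalDiscriminant_le_eighteen_of_kodairaSymbolAt_eq_Istar_succ W v hv hj hk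
  · exact h16 (by unfold WeierstrassCurve.numComponentsAt; rw [hk]; simp [KodairaSymbol.numComponents])
  · exact h16 (by unfold WeierstrassCurve.numComponentsAt; rw [hk]; simp [KodairaSymbol.numComponents])
  · exact h16 (by unfold WeierstrassCurve.numComponentsAt; rw [hk]; simp [KodairaSymbol.numComponents])

end Summit.ABC.ABC.Theorems.SingleTowerSzpiroLine

end
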